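import Summits.CriticalPhenomena.PercolationContinuityZ3.Theorems.Transplant.KNCells2TubeSub
import Summits.CriticalPhenomena.PercolationContinuityZ3.Theorems.Transplant.KNCells2AdvPackaging
import Summits.CriticalPhenomena.PercolationContinuityZ3.Theorems.Transplant.KNCellsBoxProdZ2ConcG
import Summits.CriticalPhenomena.PercolationContinuityZ3.Theorems.Transplant.BoxProdZ2ConcAssemblyG
import HarnessLib

/-!
# Design (D), instance assembly (R): the ROOT RESIDUE `RootOblA` (KNCells2AdvPackaging; ⟹ stmt-g5's `RootOblT` by `rootOblT_of_rootOblA`)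
# for the concentric scheme `concSchemeG X C w₀ Λ q δc` from ONE straight-run tube chain per direction `du` in the tube `B_X(w₀, Rt)`
# (p5-g3's option (a) 15:01Z: `Rt = rM_0(child) = F(1) - L'`, full cross-section true targets; the wired root cube `Q_0` is AVOIDED by every
# region), three RADIUS facts and three PLANAR facts of the run, and — as hypotheses in p3-g2's vocabulary — the per-step kit clauses
# (`hkits_tube₂`), the rim excess (`real_rim_le_of_radius`), the monotone-wired first hop into `B₀` (`link_seed_center_of_leQ`) and the count

builds on p205010 (kernel theorem, internal audit signed; external expert review pending) — nothing in this file uses p205010.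
Lane `prim-bschramm`, seat `prim-bschramm-p2` (owner split 15:02:43Z: (R) = p2); helper file (`--supports stmt-CriticalPhenomena-4575`).

THE FACTS per direction `du` (child `y = 0 + du`; all hold for `Λ := concRadiiGB …` by stmt's ConcRealised at `(α, β) = (0, 0)`):
radii `Rt ≤ rB 0 0 du` (`= F 1`), `Rt ≤ rQ 0 y` (`= E 1`), `Rt ≤ rM 0 y` (`= F 1 - L'`); planar: every region `aregion k ⊆ C.Btw 0 du ∪ C.Q y`
and `Disjoint (aregion k) (C.Q 0)` (`k ≤ nA`), and the far face `acore (nA + 1) ⊆ C.M y`.  Then the cut root world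
`U' := (Q_0 ∪ E_{0,du}).filter (·.1 ∈ B(w₀,Rt))` carries every region, the root law cut to `U'` is a subbox weighting of the tube graph on each
(`isSubbox_W0sub_tube`, p222000 — no separation input), the root `(w₀, 0)` is off every region, and the far face lies in `M_0(y)`.
* **`rootOblA_concG`** — `KSchA.RootOblA X (concSchemeG X C w₀ Λ q δc) Δ' δr` from `du`-indexed data `P du : TubeAdvData W`, `B₀ du`, `η du`.
[cite: KozmaNitzan2024, §4 p. 27 (G₀), p. 28 ((32) at the root), Lemma 11 (pp. 22–23)]
-/

noncomputable section

open MeasureTheory ProbabilityTheory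
open scoped ENNReal Classical

namespace Summit.CriticalPhenomena.PercolationContinuityZ3.Theorems

namespace Transplant

namespace BoxProdZ2

open Literature.Probability.Percolation Literature.Probability.LatticeModels SimpleGraph GadgetSystem ProbeHistory HSiteScheme Contour KNCells
open Literature.Barriers.CriticalPhenomena (mem_graphBall_self)

variable {W : Type} [DecidableEq W] (X : SimpleGraph W) [X.LocallyFinite]

/-- **THE ROOT RESIDUE OF THE CONCENTRIC SCHEME** (design (D), (R)): `RootOblA` from one straight run per direction in the tube `B_X(w₀, Rt du)`
avoiding the wired root cube. [cite: KozmaNitzan2024, §4 p. 28 ((32) at the root), Lemma 11 (pp. 22–23)] -/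
theorem rootOblA_concG (C : PCells) (w₀ : W) (Λ : ConcRadiiG) (q : unitInterval) (δc : ℝ) {Δ' : ℕ} {δr : ℕ → ℝ}
    (P : MDir → TubeAdvData W) (Rt : MDir → ℕ) (B₀ : MDir → Finset (W × Site 2)) (η : MDir → ℝ)
    -- the data of the runs
    (hPπ : ∀ du, (P du).π = ballFin X w₀ (Rt du)) (hProot : ∀ du, (P du).root = (w₀, 0))
    (hPS : ∀ du, (P du).Sfin = ((concSchemeG X C w₀ Λ q δc).U0root du).filter fun y => y.1 ∈ ballFin X w₀ (Rt du))
    (hsg : ∀ du, (P du).sg = 1 ∨ (P du).sg = -1)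
    (hOK : ∀ du, ChainPlanar.Adv.AdvOK (P du).q (P du).q' (P du).s₁ (P du).ρ (P du).R' (P du).ℓ₀ (P du).nA)
    (hRl : ∀ du, (P du).Rlev + 1 ≤ (P du).R') (hRim : ∀ du k, (P du).Rim k ⊆ (P du).stepD k) (hj : ∀ du, (P du).j₁ ≤ (P du).Rlev)
    -- three radius facts
    (hRB : ∀ du, Rt du ≤ Λ.rB 0 0 du) (hRQ : ∀ du, Rt du ≤ Λ.rQ 0 ((0 : Site 2) + stepVec du))
    (hRM : ∀ du, Rt du ≤ Λ.rM 0 ((0 : Site 2) + stepVec du))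
    -- three planar facts
    (hreg : ∀ du, ∀ k ≤ (P du).nA, (P du).aregion k ⊆ C.Btw 0 du ∪ C.Q ((0 : Site 2) + stepVec du))
    (hQ0 : ∀ du, ∀ k ≤ (P du).nA, Disjoint ((P du).aregion k) (C.Q 0))
    (hlast : ∀ du, (P du).acore ((P du).nA + 1) ⊆ C.M ((0 : Site 2) + stepVec du))
    -- the analytic inputs (p3-g2 / lead)
    (hcount : ∀ du, 1 / (1 - (q : ℝ)) ^ (Δ' * (P du).N) ≤ δr (P du).nA * ((Finset.Icc (P du).j₀ (P du).j₁).card : ℝ))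
    (hkits : ∀ du, ∀ k ≤ (P du).nA, ∀ j ∈ Finset.Icc (P du).j₀ (P du).j₁,
      ∃ (σ : KNLevels.SData (W × Site 2)) (Sz : Finset (W × Site 2)),
      KNLevels.SHyp (tubeLData X (P du).π ((P du).alo k) ((P du).ahi k) (P du).root (P du).Sfin) j σ ∧ σ.N ≤ (P du).N ∧
      (1 - (q : ℝ) ^ σ.sB) ^ σ.k ≤ δr (P du).nA ∧ Sz ⊆ (tubeLData X (P du).π ((P du).alo k) ((P du).ahi k) (P du).root (P du).Sfin).X j ∧
      Sz ⊆ (P du).stepD k ∧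
      (∀ x ∈ σ.K, ∀ e' ∈ σ.seed x, e' ∉ wireSet (↑Sz : Set (W × Site 2))) ∧ (∀ x ∈ σ.K, σ.face x ⊆ Sz) ∧
      (∀ x ∈ σ.K, 1 - 3 * δr (P du).nA ≤ (prodBernoulli ((concSchemeG X C w₀ Λ q δc).W0sub (X □ zdGraph 2)
          (((concSchemeG X C w₀ Λ q δc).U0root du).filter fun y => y.1 ∈ ballFin X w₀ (Rt du)))).real {ω | ∃ u ∈ σ.face x,
        1 - δr (P du).nA < (prodBernoulli (pinW ((concSchemeG X C w₀ Λ q δc).W0sub (X □ zdGraph 2)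
          (((concSchemeG X C w₀ Λ q δc).U0root du).filter fun y => y.1 ∈ ballFin X w₀ (Rt du)))
          (wireSet (↑Sz : Set (W × Site 2))) ω)).real
          (⋃ t ∈ (P du).coreE k, openConnIn (↑((P du).stepD k) : Set (W × Site 2)) u t)}))
    (hη : ∀ du, η du ≤ δr (P du).nA / 2)
    (hexc : ∀ du, ∀ k ≤ (P du).nA, (prodBernoulli ((concSchemeG X C w₀ Λ q δc).W0sub (X □ zdGraph 2)
        (((concSchemeG X C w₀ Λ q δc).U0root du).filter fun y => y.1 ∈ ballFin X w₀ (Rt du)))).real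
        (⋃ t ∈ (P du).Rim k, openConn ((w₀, (0 : Site 2)) : W × Site 2) t) ≤ η du)
    {π₀ : MDir → Finset W} {Bpl : MDir → Finset (Site 2)} (hB₀ : ∀ du, B₀ du = π₀ du ×ˢ Bpl du)
    (hπ₀ : ∀ du, π₀ du ⊆ ballFin X w₀ (Rt du)) (hBpl : ∀ du, Bpl du ⊆ (P du).acore 0)
    (hsrc : ∀ du, 1 - δr (P du).nA < (prodBernoulli ((concSchemeG X C w₀ Λ q δc).W0sub (X □ zdGraph 2)
        (((concSchemeG X C w₀ Λ q δc).U0root du).filter fun y => y.1 ∈ ballFin X w₀ (Rt du)))).real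
        (⋃ t ∈ B₀ du, openConn ((w₀, (0 : Site 2)) : W × Site 2) t)) :
    KSchA.RootOblA X (concSchemeG X C w₀ Λ q δc) Δ' δr := by
  intro du
  set S := concSchemeG X C w₀ Λ q δc with hSdef
  set U' : Finset (W × Site 2) := (S.U0root du).filter fun y => y.1 ∈ ballFin X w₀ (Rt du) with hU'
  have hw₀ : w₀ ∈ ballFin X w₀ (Rt du) := (mem_ballFin X).2 (mem_graphBall_self X w₀ _)
  -- the root lies in the cut root world
  have hrootQ : ((w₀, (0 : Site 2)) : W × Site 2) ∈ S.Γ.Q S.Γ.a₀ 0 := by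
    change (w₀, (0 : Site 2)) ∈ ballFin X w₀ (Λ.rQ 0 0) ×ˢ C.Q 0
    exact Finset.mem_product.2 ⟨(mem_ballFin X).2 (mem_graphBall_self X w₀ _), C.zero_mem_Q_zero⟩
  have hrootU : ((w₀, (0 : Site 2)) : W × Site 2) ∈ U' :=
    Finset.mem_filter.2 ⟨Finset.mem_union_left _ hrootQ, hw₀⟩
  -- every region lies in the cut root world
  have hDU : ∀ k ≤ (P du).nA, (P du).stepD k ⊆ U' := by
    intro k hk v hv
    have hv' := hv
    rw [TubeAdvData.stepD, hPπ, Finset.mem_product] at hv'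
    obtain ⟨hv1, hv2⟩ := hv'
    refine Finset.mem_filter.2 ⟨?_, hv1⟩
    rcases Finset.mem_union.1 (hreg du k hk hv2) with hv2 | hv2
    · -- the between-box `Btw_0(0, du)`
      refine Finset.mem_union_right _ (Finset.mem_union_left _ ?_)
      change v ∈ ballFin X w₀ (Λ.rB 0 0 du) ×ˢ C.Btw 0 du
      exact Finset.mem_product.2 ⟨ballFin_mono X w₀ (hRB du) hv1, hv2⟩
    · -- the child's cube `Q_0(0 + du)`
      refine Finset.mem_union_right _ (Finset.mem_union_right _ ?_)
      change v ∈ ballFin X w₀ (Λ.rQ 0 ((0 : Site 2) + stepVec du)) ×ˢ C.Q ((0 : Site 2) + stepVec du)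
      exact Finset.mem_product.2 ⟨ballFin_mono X w₀ (hRQ du) hv1, hv2⟩
  -- … and off the wired root cube
  have hdis : ∀ k ≤ (P du).nA, Disjoint ((P du).stepD k) (S.Γ.Q S.Γ.a₀ 0) := by
    intro k hk
    change Disjoint ((P du).π ×ˢ (P du).aregion k) (ballFin X w₀ (Λ.rQ 0 0) ×ˢ C.Q 0)
    exact disjoint_product_of_right (hQ0 du k hk)
  refine ⟨P du, U', B₀ du, η du, hsg du, hOK du, hRl du, hRim du, ?_, ?_, Finset.filter_subset _ _, hrootU, ?_, ?_, ?_, ?_, ?_,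
    hj du, hcount du, ?_, hη du, ?_, ?_, ?_, ?_⟩
  · -- the window is nonempty
    rw [hPπ]; exact ⟨w₀, hw₀⟩
  · -- the sources agree
    rw [hProot]; rfl
  · -- subbox in the tube graph
    intro k hk
    rw [hPπ]
    exact KSchA.isSubbox_W0sub_tube X (S := S) (ballFin X w₀ (Rt du)) (U := S.U0root du) (hDU k hk) (hdis k hk)
  · -- finite support
    rw [hPS]; exact KSchA.finSupp_W0sub
  · -- regions inside the support
    intro k hk; rw [hPS]; exact hDU k hk
  · -- the root is off every region
    intro k hk; rw [hProot]
    exact fun h' => Finset.disjoint_left.1 (hdis k hk) h' hrootQ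
  · -- the root is in the support
    rw [hProot, hPS]; exact hrootU
  · -- the kit clauses
    intro k hk j hjj
    exact hkits du k hk j hjj
  · -- the rim excess
    intro k hk; exact hexc du k hk
  · -- the first-hop box lies in the first level
    rw [hB₀, TubeAdvData.stepL_X_zero _ _ (hsg du), hPπ]
    exact Finset.product_subset_product (hπ₀ du) (hBpl du)
  · -- the first hop
    exact hsrc du
  · -- the far face lies in `M_0(0 + du)`
    rw [TubeAdvData.coreT, hPπ]
    change ballFin X w₀ (Rt du) ×ˢ (P du).acore ((P du).nA + 1) ⊆
      ballFin X w₀ (Λ.rM 0 ((0 : Site 2) + stepVec du)) ×ˢ C.M ((0 : Site 2) + stepVec du)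
    exact Finset.product_subset_product (ballFin_mono X w₀ (hRM du)) (hlast du)

end BoxProdZ2

end Transplant

end Summit.CriticalPhenomena.PercolationContinuityZ3.Theorems

end
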